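import Mathlib
import HarnessLib
import Summits.ValiantsHypothesis.ValiantsHypothesis.Theorems.MonotoneRestorationQP.Negative.OrbitRestorationFalseOfPolylogWidthVP
import Summits.ValiantsHypothesis.ValiantsHypothesis.Theorems.MonotoneRestorationMonotoneRestorationQPOrbitCutIff

/-!
# Route MonotoneRestoration, cruxes `MonotoneRestorationQP` (stmt-15886) and `NonnegRestorationQP` (stmt-16191) —
# THE LOSSLESS SIMPLE-GRAPH CUT IN THE MONOTONE / NONNEGATIVE SIZE CURRENCY

Helper file (`--supports`), def-free; the size-currency twin of `…OrbitRestorationQPSimpleGraphCut.lean`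
(`SimpleGraphCut.orbitRestorationQP_iff_simpleGraphCut`, the cut of L1 = `OrbitRestorationQP`).
The route files `PolylogWidthMonotoneEasy` (stmt-17619) as the KILL WITNESS of the monotone crux and proves the
kill glue `WidthKillsRestoration : PolylogWidthMonotoneEasy → ¬ MonotoneRestorationQP`.  Read contrapositively this
is one half of a LOSSLESS cut of the crux itself, which this file states and proves by name:

* `monotoneHalf_iff_not_polylogWidthMonotoneEasy` — Hᵐ, "every monotone-easy matrix-symmetric nonnegative family
  (the exact hypothesis class of `MonotoneRestorationQP`) is EVENTUALLY `C^{(log₂ m + c)^c}`-determined on simple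
  graphs", is LITERALLY `¬ PolylogWidthMonotoneEasy`;
* `monotoneRestorationQP_iff_simpleGraphCut` — `MonotoneRestorationQP ⟺ Wᵐ ∧ Hᵐ`, where Wᵐ = "eventual
  simple-graph determination ⇒ square-symmetric circuits of quasi-polynomial SIZE" for that class; `⟹` through
  `orbitSize ≤ size` and the orbit-form engine `not_qpOrbitSymmetric_of_polylogSeparating` applied to the
  complexification, `⟸` by composition;
* `monotoneRestorationQP_iff_cut_witness` — hence `MonotoneRestorationQP ⟺ Wᵐ ∧ ¬ PolylogWidthMonotoneEasy`:
  the crux is EXACTLY its circuit half plus the failure of its filed kill witness;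
* `nonnegRestorationQP_iff_simpleGraphCut` — the same cut for the target `NonnegRestorationQP` (hypothesis class:
  nonnegative matrix-symmetric families with `VP` complexification), and `nonnegRestorationQP_iff_monotone_cut`
  (through `monotoneRestorationQP_iff_nonnegRestorationQP`, p823507) expressing the target by the monotone cut.

So for all three items of the route's line-first census (18293 via the twin file, 15886, 16191) the registered
stubs' "finite-model-theory half" is now typed in the ONE currency in which the tree holds the whole lower-bound
pipeline (Hella games `CkEquiv`, Dvořák, Cai–Fürer–Immerman graphs, Dawar–Wilsenach supports): a refuter needs ONE
separating family, a prover needs W plus H, and nothing else.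
Honest label: by-name glue; no stub closed; the cruxes and VP ≠ VNP NOT moved.
[cite: DawarWilsenach2025, Thm 5.1, §6, §8; AndersonDawar2016, Thm 6; DwivediPagoSeppelt2026, Outlook Q3]
-/

-- `Summit.ValiantsHypothesis.ValiantsHypothesis.…` is the tree's mandated namespace (Sub = Summit).
set_option linter.dupNamespace false

noncomputable section

namespace Summit.ValiantsHypothesis.ValiantsHypothesis.Theorems

namespace SimpleGraphCut

open Summit.ValiantsHypothesis.ValiantsHypothesis.Theses.MonotoneRestoration
open Literature.Computability.AlgebraicComplexity
open Literature.ModelTheory.FiniteModelTheory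
open MvPolynomial

/-! ### The engine in size currency -/

/-- **Size form of the engine.** A complex family whose values separate, for every level and beyond every order,
two `≡^{C^{(log₂ m + c)^c}}`-equivalent simple graphs has no square-symmetric circuits of quasi-polynomial SIZE
(`orbitSize ≤ size`, then `not_qpOrbitSymmetric_of_polylogSeparating`). [cite: DawarWilsenach2025, Thm 5.1, §6] -/
theorem not_qpSizeSymmetric_of_polylogSeparating (g : (n : ℕ) → MvPolynomial (Fin n × Fin n) ℂ)
    (hsep : ∀ c N : ℕ, ∃ m : ℕ, N ≤ m ∧ ∃ X Y : SimpleGraph (Fin m),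
      CkEquiv ((Nat.log 2 m + c) ^ c) X Y ∧
        MvPolynomial.eval (Set.indicator {ij : Fin m × Fin m | X.Adj ij.1 ij.2} 1) (g m) ≠
          MvPolynomial.eval (Set.indicator {ij : Fin m × Fin m | Y.Adj ij.1 ij.2} 1) (g m)) :
    ¬ ∃ c : ℕ, ∀ n : ℕ, ∃ (G : Type) (_ : Fintype G) (C : LabelledArithCircuit ℂ (Fin n × Fin n) Unit G),
      C.IsSymmetric (Equiv.Perm (Fin n)) ∧ C.eval (C.output ()) = g n ∧
        Fintype.card G ≤ 2 ^ ((Nat.log 2 n + c) ^ c) := by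
  rintro ⟨c, hc⟩
  refine not_qpOrbitSymmetric_of_polylogSeparating g hsep ⟨c, fun n => ?_⟩
  obtain ⟨G, inst, C, hsym, hev, hcard⟩ := hc n
  exact ⟨G, inst, C, hsym, hev, (C.orbitSize_le_size _).trans hcard⟩

/-! ### The monotone crux `MonotoneRestorationQP` (stmt-15886) -/

/-- **Hᵐ is literally the negation of the kill witness.**  "Every monotone-easy matrix-symmetric nonnegative family
is eventually `C^{polylog}`-determined on simple graphs" ⟺ `¬ PolylogWidthMonotoneEasy` (stmt-17619). [folklore] -/
theorem monotoneHalf_iff_not_polylogWidthMonotoneEasy :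
    (∀ f : (n : ℕ) → MvPolynomial (Fin n × Fin n) NNReal,
      (∀ (n : ℕ) (σ τ : Equiv.Perm (Fin n)),
        MvPolynomial.rename (fun p : Fin n × Fin n => (σ p.1, τ p.2)) (f n) = f n) →
      (∃ c : ℕ, ∀ n : ℕ, (f n).totalDegree ≤ (n + 2) ^ c ∧ complexity (k := NNReal) (f n) ≤ (n + 2) ^ c) →
      ∃ c N : ℕ, ∀ m : ℕ, N ≤ m → ∀ X Y : SimpleGraph (Fin m), CkEquiv ((Nat.log 2 m + c) ^ c) X Y →
        MvPolynomial.eval (Set.indicator {ij : Fin m × Fin m | X.Adj ij.1 ij.2} 1)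
            (MvPolynomial.map (Complex.ofRealHom.comp NNReal.toRealHom) (f m)) =
          MvPolynomial.eval (Set.indicator {ij : Fin m × Fin m | Y.Adj ij.1 ij.2} 1)
            (MvPolynomial.map (Complex.ofRealHom.comp NNReal.toRealHom) (f m))) ↔
      ¬ PolylogWidthMonotoneEasy := by
  unfold PolylogWidthMonotoneEasy
  push Not
  rfl

/-- **`MonotoneRestorationQP ⟺ Wᵐ ∧ Hᵐ` (the lossless simple-graph cut of the monotone crux).**  Wᵐ: every
monotone-easy matrix-symmetric nonnegative family that is eventually `C^{(log₂ m + c)^c}`-determined on simple graphs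
has square-symmetric circuits over `ℂ` of quasi-polynomial SIZE; Hᵐ: every such family is eventually so determined.
`⟹`: Wᵐ is the crux with an idle hypothesis, Hᵐ is the contrapositive of the size-form engine on the
complexification; `⟸`: composition. [cite: DawarWilsenach2025, Thm 5.1, §6; AndersonDawar2016, Thm 6] -/
theorem monotoneRestorationQP_iff_simpleGraphCut :
    MonotoneRestorationQP ↔
      ((∀ f : (n : ℕ) → MvPolynomial (Fin n × Fin n) NNReal,
        (∀ (n : ℕ) (σ τ : Equiv.Perm (Fin n)),
          MvPolynomial.rename (fun p : Fin n × Fin n => (σ p.1, τ p.2)) (f n) = f n) →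
        (∃ c : ℕ, ∀ n : ℕ, (f n).totalDegree ≤ (n + 2) ^ c ∧ complexity (k := NNReal) (f n) ≤ (n + 2) ^ c) →
        (∃ c N : ℕ, ∀ m : ℕ, N ≤ m → ∀ X Y : SimpleGraph (Fin m), CkEquiv ((Nat.log 2 m + c) ^ c) X Y →
          MvPolynomial.eval (Set.indicator {ij : Fin m × Fin m | X.Adj ij.1 ij.2} 1)
              (MvPolynomial.map (Complex.ofRealHom.comp NNReal.toRealHom) (f m)) =
            MvPolynomial.eval (Set.indicator {ij : Fin m × Fin m | Y.Adj ij.1 ij.2} 1)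
              (MvPolynomial.map (Complex.ofRealHom.comp NNReal.toRealHom) (f m))) →
        ∃ c : ℕ, ∀ n : ℕ, ∃ (G : Type) (_ : Fintype G)
          (C : LabelledArithCircuit ℂ (Fin n × Fin n) Unit G),
          C.IsSymmetric (Equiv.Perm (Fin n)) ∧
            C.eval (C.output ()) = MvPolynomial.map (Complex.ofRealHom.comp NNReal.toRealHom) (f n) ∧
              Fintype.card G ≤ 2 ^ ((Nat.log 2 n + c) ^ c)) ∧
      ∀ f : (n : ℕ) → MvPolynomial (Fin n × Fin n) NNReal,
        (∀ (n : ℕ) (σ τ : Equiv.Perm (Fin n)),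
          MvPolynomial.rename (fun p : Fin n × Fin n => (σ p.1, τ p.2)) (f n) = f n) →
        (∃ c : ℕ, ∀ n : ℕ, (f n).totalDegree ≤ (n + 2) ^ c ∧ complexity (k := NNReal) (f n) ≤ (n + 2) ^ c) →
        ∃ c N : ℕ, ∀ m : ℕ, N ≤ m → ∀ X Y : SimpleGraph (Fin m), CkEquiv ((Nat.log 2 m + c) ^ c) X Y →
          MvPolynomial.eval (Set.indicator {ij : Fin m × Fin m | X.Adj ij.1 ij.2} 1)
              (MvPolynomial.map (Complex.ofRealHom.comp NNReal.toRealHom) (f m)) =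
            MvPolynomial.eval (Set.indicator {ij : Fin m × Fin m | Y.Adj ij.1 ij.2} 1)
              (MvPolynomial.map (Complex.ofRealHom.comp NNReal.toRealHom) (f m))) := by
  constructor
  · intro hcrux
    refine ⟨fun f hs hc _ => hcrux f hs hc, fun f hs hc => ?_⟩
    by_contra hdet
    push Not at hdet
    exact not_qpSizeSymmetric_of_polylogSeparating _ hdet (hcrux f hs hc)
  · rintro ⟨hW, hH⟩ f hs hc
    exact hW f hs hc (hH f hs hc)

/-- **`MonotoneRestorationQP ⟺ Wᵐ ∧ ¬ PolylogWidthMonotoneEasy`.**  The monotone crux is exactly its circuit half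
plus the failure of its filed kill witness (stmt-17619); in particular `WidthKillsRestoration` is the `⟹`, second
component. [folklore] -/
theorem monotoneRestorationQP_iff_cut_witness :
    MonotoneRestorationQP ↔
      ((∀ f : (n : ℕ) → MvPolynomial (Fin n × Fin n) NNReal,
        (∀ (n : ℕ) (σ τ : Equiv.Perm (Fin n)),
          MvPolynomial.rename (fun p : Fin n × Fin n => (σ p.1, τ p.2)) (f n) = f n) →
        (∃ c : ℕ, ∀ n : ℕ, (f n).totalDegree ≤ (n + 2) ^ c ∧ complexity (k := NNReal) (f n) ≤ (n + 2) ^ c) →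
        (∃ c N : ℕ, ∀ m : ℕ, N ≤ m → ∀ X Y : SimpleGraph (Fin m), CkEquiv ((Nat.log 2 m + c) ^ c) X Y →
          MvPolynomial.eval (Set.indicator {ij : Fin m × Fin m | X.Adj ij.1 ij.2} 1)
              (MvPolynomial.map (Complex.ofRealHom.comp NNReal.toRealHom) (f m)) =
            MvPolynomial.eval (Set.indicator {ij : Fin m × Fin m | Y.Adj ij.1 ij.2} 1)
              (MvPolynomial.map (Complex.ofRealHom.comp NNReal.toRealHom) (f m))) →
        ∃ c : ℕ, ∀ n : ℕ, ∃ (G : Type) (_ : Fintype G)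
          (C : LabelledArithCircuit ℂ (Fin n × Fin n) Unit G),
          C.IsSymmetric (Equiv.Perm (Fin n)) ∧
            C.eval (C.output ()) = MvPolynomial.map (Complex.ofRealHom.comp NNReal.toRealHom) (f n) ∧
              Fintype.card G ≤ 2 ^ ((Nat.log 2 n + c) ^ c)) ∧
      ¬ PolylogWidthMonotoneEasy) := by
  rw [← monotoneHalf_iff_not_polylogWidthMonotoneEasy]
  exact monotoneRestorationQP_iff_simpleGraphCut

/-! ### The target `NonnegRestorationQP` (stmt-16191) -/

/-- **`NonnegRestorationQP ⟺ Wⁿ ∧ Hⁿ` (the lossless simple-graph cut of the target).**  Hypothesis class: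
nonnegative matrix-symmetric families whose complexification is a `VP` family; Wⁿ / Hⁿ as in the monotone cut with
this class. [cite: DawarWilsenach2025, Thm 5.1, §6; AndersonDawar2016, Thm 6] -/
theorem nonnegRestorationQP_iff_simpleGraphCut :
    NonnegRestorationQP ↔
      ((∀ h : (n : ℕ) → MvPolynomial (Fin n × Fin n) NNReal,
        (∀ (n : ℕ) (σ τ : Equiv.Perm (Fin n)),
          MvPolynomial.rename (fun p : Fin n × Fin n => (σ p.1, τ p.2)) (h n) = h n) →
        IsVPFamily (fun n => MvPolynomial.map (Complex.ofRealHom.comp NNReal.toRealHom) (h n)) →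
        (∃ c N : ℕ, ∀ m : ℕ, N ≤ m → ∀ X Y : SimpleGraph (Fin m), CkEquiv ((Nat.log 2 m + c) ^ c) X Y →
          MvPolynomial.eval (Set.indicator {ij : Fin m × Fin m | X.Adj ij.1 ij.2} 1)
              (MvPolynomial.map (Complex.ofRealHom.comp NNReal.toRealHom) (h m)) =
            MvPolynomial.eval (Set.indicator {ij : Fin m × Fin m | Y.Adj ij.1 ij.2} 1)
              (MvPolynomial.map (Complex.ofRealHom.comp NNReal.toRealHom) (h m))) →
        ∃ c : ℕ, ∀ n : ℕ, ∃ (G : Type) (_ : Fintype G)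
          (C : LabelledArithCircuit ℂ (Fin n × Fin n) Unit G),
          C.IsSymmetric (Equiv.Perm (Fin n)) ∧
            C.eval (C.output ()) = MvPolynomial.map (Complex.ofRealHom.comp NNReal.toRealHom) (h n) ∧
              Fintype.card G ≤ 2 ^ ((Nat.log 2 n + c) ^ c)) ∧
      ∀ h : (n : ℕ) → MvPolynomial (Fin n × Fin n) NNReal,
        (∀ (n : ℕ) (σ τ : Equiv.Perm (Fin n)),
          MvPolynomial.rename (fun p : Fin n × Fin n => (σ p.1, τ p.2)) (h n) = h n) →
        IsVPFamily (fun n => MvPolynomial.map (Complex.ofRealHom.comp NNReal.toRealHom) (h n)) →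
        ∃ c N : ℕ, ∀ m : ℕ, N ≤ m → ∀ X Y : SimpleGraph (Fin m), CkEquiv ((Nat.log 2 m + c) ^ c) X Y →
          MvPolynomial.eval (Set.indicator {ij : Fin m × Fin m | X.Adj ij.1 ij.2} 1)
              (MvPolynomial.map (Complex.ofRealHom.comp NNReal.toRealHom) (h m)) =
            MvPolynomial.eval (Set.indicator {ij : Fin m × Fin m | Y.Adj ij.1 ij.2} 1)
              (MvPolynomial.map (Complex.ofRealHom.comp NNReal.toRealHom) (h m))) := by
  constructor
  · intro hX
    refine ⟨fun h hs hVP _ => hX h hs hVP, fun h hs hVP => ?_⟩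
    by_contra hdet
    push Not at hdet
    exact not_qpSizeSymmetric_of_polylogSeparating _ hdet (hX h hs hVP)
  · rintro ⟨hW, hH⟩ h hs hVP
    exact hW h hs hVP (hH h hs hVP)

/-- **The target by the monotone cut**: `NonnegRestorationQP ⟺ Wᵐ ∧ ¬ PolylogWidthMonotoneEasy`
(`monotoneRestorationQP_iff_nonnegRestorationQP`, p823507, then `monotoneRestorationQP_iff_cut_witness`). [folklore] -/
theorem nonnegRestorationQP_iff_monotone_cut :
    NonnegRestorationQP ↔
      ((∀ f : (n : ℕ) → MvPolynomial (Fin n × Fin n) NNReal,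
        (∀ (n : ℕ) (σ τ : Equiv.Perm (Fin n)),
          MvPolynomial.rename (fun p : Fin n × Fin n => (σ p.1, τ p.2)) (f n) = f n) →
        (∃ c : ℕ, ∀ n : ℕ, (f n).totalDegree ≤ (n + 2) ^ c ∧ complexity (k := NNReal) (f n) ≤ (n + 2) ^ c) →
        (∃ c N : ℕ, ∀ m : ℕ, N ≤ m → ∀ X Y : SimpleGraph (Fin m), CkEquiv ((Nat.log 2 m + c) ^ c) X Y →
          MvPolynomial.eval (Set.indicator {ij : Fin m × Fin m | X.Adj ij.1 ij.2} 1)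
              (MvPolynomial.map (Complex.ofRealHom.comp NNReal.toRealHom) (f m)) =
            MvPolynomial.eval (Set.indicator {ij : Fin m × Fin m | Y.Adj ij.1 ij.2} 1)
              (MvPolynomial.map (Complex.ofRealHom.comp NNReal.toRealHom) (f m))) →
        ∃ c : ℕ, ∀ n : ℕ, ∃ (G : Type) (_ : Fintype G)
          (C : LabelledArithCircuit ℂ (Fin n × Fin n) Unit G),
          C.IsSymmetric (Equiv.Perm (Fin n)) ∧
            C.eval (C.output ()) = MvPolynomial.map (Complex.ofRealHom.comp NNReal.toRealHom) (f n) ∧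
              Fintype.card G ≤ 2 ^ ((Nat.log 2 n + c) ^ c)) ∧
      ¬ PolylogWidthMonotoneEasy) := by
  rw [← MonotoneRestorationQPOrbitCut.monotoneRestorationQP_iff_nonnegRestorationQP]
  exact monotoneRestorationQP_iff_cut_witness

end SimpleGraphCut

end Summit.ValiantsHypothesis.ValiantsHypothesis.Theorems

end
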